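import Summits.BirchSwinnertonDyer.BirchSwinnertonDyer.Theorems.SignedLowerHalvesSmallImageLowerHalfBothSignsLambdaLowerThreeNsThetaPartnerSharpExportStable
import Summits.BirchSwinnertonDyer.BirchSwinnertonDyer.Theorems.SignedLowerHalvesSmallImageLowerHalfBothSignsRttOneSidedCruxThetaPartner
import Literature.NumberTheory.GaloisRepresentations.HeckeCharacter
import HarnessLib

/-!
# Route `SignedLowerHalves`, crux L `SmallImageLowerHalfBothSigns` (item stmt-BirchSwinnertonDyer-23599), line `rtt_w3` v45 —
# tier T3′: the ∃-partner Selmer bound FROM PSB_θψ′ (the partner Selmer bound on the SHARP-MODULUS prefix), via the sharp producer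

LEAD `cruxlead-stmt-BirchSwinnertonDyer-23599` g16 (RULING «SHARP-1», crux dir `Lines/rtt_w3-BRIEF-SHARP-g16.md`); helper
`--supports stmt-BirchSwinnertonDyer-23599`; THEOREMS ONLY, no `sorry`; closes nothing; BSD / crux L / PSB_θψ′ are NOT proved by any of this.

WHAT. `existsPartnerSelmerBoundT3_ns_of_psbTheta_sharp` = `existsPartnerSelmerBoundT3_ns_of_psbTheta` (this namespace, `…RttOneSidedCruxThetaPartner.lean`)
with the hypothesis PSB_θψ replaced by the WEAKER PSB_θψ′: its arithmetic-half ∀-block carries, right after `¬ (p : ℤ) ∣ discr K`, the three partner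
properties (E1) `hprim` (every idelic Hecke character eventually equal to `ψ` on uniformizers is ramified at every prime of `𝔪` — sharp support),
(E2) `hdK` (`supp d_K ⊆ supp 𝔪`), (E3) `h𝔪c` (`cK • 𝔪 = 𝔪` for every `cK ∈ Aut(K/ℚ)`), exactly as exported by the sharp-modulus producer
`SmallImageLambdaLowerThreeNsThetaPartner.exists_arithmeticHalf_classwide_sharp₃` (honda g32, p830978). Same conclusion (the `hEX3` of
`smallImageLowerHalfBothSigns_of_oneSignFloor_of_existsPartnerPSB`, p754919). Proof verbatim: sharp producer + K0₂'s
`heckeThetaPartner_withCoeff_of_arithmeticHalf` on the sharpened pair + `hPSBθ`.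

References: [Ribet1977Nebentypus] §3 Thm. (3.4), Cor. (3.5); [Serre1972] §2.2, §4.2 c), §5.2 (iv); [NeukirchANT1999] Ch. VII §6 Cor. (6.14);
[Kobayashi2003] Conjecture (p. 2); [PollackWeston2011MT] §3.1.
-/

set_option autoImplicit false
-- D-0017: single-problem summit, the namespace repeats the problem name by design.
set_option linter.dupNamespace false
noncomputable section

open scoped Classical MatrixGroups ModularForm BigOperators NumberField Pointwise

open CongruenceSubgroup WeierstrassCurve Field Polynomial NumberField IsDedekindDomain Matrix
  Literature.NumberTheory.EllipticCurves Literature.NumberTheory.EllipticCurves.ModularForms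
  Literature.NumberTheory.EllipticCurves.Rank1Residual
  Literature.NumberTheory.EllipticCurves.Kobayashi2003
  Literature.NumberTheory.EllipticCurves.GreenbergVatsal2000 ZpExtension
  Literature.NumberTheory.IwasawaTheory Rat.HeightOneSpectrum
  Literature.NumberTheory.GaloisRepresentations Literature.NumberTheory.LFunctions
  Literature.NumberTheory.GaloisRepresentations.HeckeCharacter Literature.NumberTheory.Automorphic
  Summit.BirchSwinnertonDyer.Rank1Residual Summit.BirchSwinnertonDyer.Rank1Residual.Supersingular
  Summit.BirchSwinnertonDyer.Rank1Residual.X1.MuLambda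
  Summit.BirchSwinnertonDyer.Rank1Residual.X2.EulerFactorInvariants
  Summit.BirchSwinnertonDyer.BirchSwinnertonDyer.Theorems.SmallImageLambdaLowerThreeNsThetaTransport
  Summit.BirchSwinnertonDyer.BirchSwinnertonDyer.Theorems.HeckeThetaPartner

namespace Summit.BirchSwinnertonDyer.BirchSwinnertonDyer.Theorems.SmallImageRttOneSided

/-- **The v6 registered engine stub (∃-form) from PSB_θψ′ (sharp-modulus prefix).** If the partner Selmer bound holds for the theta partner
`g = θ_ψ` of every exported SHARP arithmetic half `(K, σ, 𝔪, ψ, e)` — `𝔪` sharp for `ψ` (E1), `supp d_K ⊆ supp 𝔪` (E2), `𝔪` `Aut(K/ℚ)`-stable (E3) —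
with its small-image datum `(Φ, k, e₀)` of a tier-T3 pair, then the ∃-partner Selmer bound holds — by the sharp producer
`exists_arithmeticHalf_classwide_sharp₃` and `heckeThetaPartner_withCoeff_of_arithmeticHalf`. CONDITIONAL; closes nothing.
[cite: Serre1972, §4.2 c), §5.2 (iv)] [cite: Ribet1977Nebentypus, §3 Thm. 3.6] [cite: NeukirchANT1999, Ch. VII §6 Cor. (6.14)] -/
theorem existsPartnerSelmerBoundT3_ns_of_psbTheta_sharp
    (hPSBθ : ∀ (W : WeierstrassCurve ℚ) [W.IsElliptic] [W.IsGloballyMinimal] (p : ℕ) [Fact p.Prime],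
      p ≠ 2 → ClassX7 W p → ¬ W.HasCM → W.frobeniusTrace p = 0 → ¬ Surj W p →
      ¬ (∃ (A : WeierstrassCurve ℚ) (_ : A.IsElliptic) (_ : A.IsGloballyMinimal),
        A.HasCM ∧ GoodSS A p ∧ A.frobeniusTrace p = 0 ∧
          ∃ e : geomTorsion W (p : ℤ) ≃+ geomTorsion A (p : ℤ),
            ∀ (σ : absoluteGaloisGroup ℚ) (P : geomTorsion W (p : ℤ)), e (σ • P) = σ • e P) →
      ¬ (∃ (A : WeierstrassCurve ℚ) (_ : A.IsElliptic) (_ : A.IsGloballyMinimal) (t : ℚ),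
        A.HasGoodReductionAtPrime p ∧ A.frobeniusTrace p = 0 ∧
          (∃ e : geomTorsion W (p : ℤ) ≃+ geomTorsion A (p : ℤ),
            ∀ (σ : absoluteGaloisGroup ℚ) (P : geomTorsion W (p : ℤ)), e (σ • P) = σ • e P) ∧
          A.entireLFunction 1 / (A.realPeriodRat : ℂ) = ((t : ℚ) : ℂ) ∧ t ≠ 0 ∧ padicValRat p t = 0) →
      ∀ (ε : ℤˣ) (K : Type) [Field K] [NumberField K] (σK : K →+* ℂ) (𝔪 : Ideal (𝓞 K))
        (ψ : HeightOneSpectrum (𝓞 K) → ℂ) (e : PadicAlgCl p ≃+* ℂ),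
        Module.finrank ℚ K = 2 → IsTotallyComplex K → 𝔪 ≠ ⊥ →
        (∀ I : Ideal (𝓞 K), Ideal.absNorm I ≠ p) → ¬ p ∣ (NumberField.discr K).natAbs * Ideal.absNorm 𝔪 →
        (∀ (ℓ : ℕ) [Fact ℓ.Prime], ℓ ∣ (NumberField.discr K).natAbs * Ideal.absNorm 𝔪 → ¬ W.HasGoodReductionAtPrime ℓ) →
        IsGrossencharakter 𝔪 (embType σK) (embTypeConj σK) ψ →
        (∀ n : ℕ, Odd n → n.Coprime ((NumberField.discr K).natAbs * Ideal.absNorm 𝔪) →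
          idealPow K ψ (Ideal.span {(n : 𝓞 K)}) = (jacobiSym (NumberField.discr K) n : ℂ) * (n : ℂ) ^ (2 - 1)) →
        (∀ (ℓ : ℕ) [Fact ℓ.Prime], ℓ ≠ p → W.HasGoodReductionAtPrime ℓ →
          ‖e.symm (∑ᶠ (w : HeightOneSpectrum (𝓞 K)) (_ : Ideal.absNorm w.asIdeal = ℓ), ψ w) -
            (W.frobeniusTrace ℓ : PadicAlgCl p)‖ < 1) →
        (∃ v : HeightOneSpectrum (𝓞 K), v.asIdeal = Ideal.span {(p : 𝓞 K)} ∧ Nat.card (𝓞 K ⧸ v.asIdeal) = p ^ 2) →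
        ¬ (p : ℤ) ∣ NumberField.discr K →
        (∀ χ : Literature.NumberTheory.GaloisRepresentations.HeckeCharacter K,
          (∀ᶠ v in Filter.cofinite, χ.valueAtUniformizer v = ψ v) →
          ∀ w : HeightOneSpectrum (𝓞 K), 𝔪 ≤ w.asIdeal → ¬ χ.IsUnramifiedAt w) →
        (∀ w : HeightOneSpectrum (𝓞 K), ((NumberField.discr K : ℤ) : 𝓞 K) ∈ w.asIdeal → 𝔪 ≤ w.asIdeal) →
        (∀ cK : K ≃ₐ[ℚ] K, cK • 𝔪 = 𝔪) →
      ∀ (Φ : Multiplicative (AddAut (geomTorsion W p)) ≃* GL (Fin 2) (ZMod p))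
        (k : Subalgebra (ZMod p) (Matrix (Fin 2) (Fin 2) (ZMod p))) (e₀ : geomTorsion W p ≃+ (Fin 2 → ZMod p)),
        (∀ (g : Multiplicative (AddAut (geomTorsion W p))) (x : geomTorsion W p),
          e₀ (Multiplicative.toAdd g x) = ((Φ g : GL (Fin 2) (ZMod p)) : Matrix (Fin 2) (Fin 2) (ZMod p)) *ᵥ e₀ x) →
        IsField k → Module.finrank (ZMod p) k = 2 →
        (letI : Module (ZMod p) (geomTorsion W p) := AddSubgroup.torsionBy.zmodModule
          ∀ g : Multiplicative (AddAut (geomTorsion W p)),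
            Matrix.trace ((Φ g : GL (Fin 2) (ZMod p)) : Matrix (Fin 2) (Fin 2) (ZMod p)) =
              LinearMap.trace (ZMod p) (geomTorsion W p) ((Multiplicative.toAdd g).toAddMonoidHom.toZModLinearMap p)) →
        (galoisRepTorsion W p).range.map Φ.toMonoidHom ≤
          Subgroup.normalizer (Serre1972.unitGroup k : Set (GL (Fin 2) (ZMod p))) →
        ((Serre1972.unitGroup k).comap Φ.toMonoidHom).comap (galoisRepTorsion W p) ≤
          (absGaloisRestrict ℚ K).toMonoidHom.range →
        (∀ τ : absoluteGaloisGroup K, Φ (galoisRepTorsion W p (absGaloisRestrict ℚ K τ)) ∈ Serre1972.unitGroup k) →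
      ∀ (M : ℕ) [NeZero M] (g : CuspForm (Gamma0 M) 2) (ι : coeffField g →+* PadicAlgCl p) (Ω : ℂ),
        ¬ p ∣ M → IsNewform0 g → Literature.NumberTheory.Automorphic.IsCMForm (liftToGamma1 M 2 g) →
        cuspCoeff g p = 0 → IsCohomologicalPlusPeriod g ι Ω →
        (∀ ℓ : ℕ, ℓ.Prime → ¬ ℓ ∣ p * M * W.conductorNorm ℤ →
          ‖embCoeff g ι ℓ - (W.frobeniusTrace ℓ : PadicAlgCl p)‖ < 1) →
        (∀ ℓ : ℕ, ℓ.Prime → ¬ ℓ ∣ (NumberField.discr K).natAbs * Ideal.absNorm 𝔪 →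
          embCoeff g ι ℓ = e.symm (∑ᶠ (w : HeightOneSpectrum (𝓞 K)) (_ : Ideal.absNorm w.asIdeal = ℓ), ψ w)) →
        ∀ (κ : ZpExtension ℚ p) (γ : absoluteGaloisGroup ℚ),
          κ.IsCyclotomic → κ.IsTopGenerator γ → IsCyclotomicVariable p γ →
        ∀ (S₀ : Finset (HeightOneSpectrum (𝓞 ℚ))), (∀ v ∈ S₀, ((p : ℕ) : 𝓞 ℚ) ∉ v.asIdeal) →
          (∀ v : HeightOneSpectrum (𝓞 ℚ), ¬ W.HasGoodReductionAt v → v ∈ S₀) →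
          (∀ v : HeightOneSpectrum (𝓞 ℚ), natGenerator v ∣ M → v ∈ S₀) →
        ∀ (D : SignedSelmerDualData W κ γ ε) [Module.Finite (IwasawaAlgebra p) D.X],
          Module.IsTorsion (IwasawaAlgebra p) D.X → D.mu = 0 →
        ∀ L : IwasawaAlgebraO (Set.range ι), L ≠ 0 →
          (∀ n : ℕ, (Even n ↔ ε = 1) → IsCongrModOmegaO (Set.range ι) n ((mazurTateElementK g Ω p n).map ι)
            (((((-1) ^ (n / 2 + 1) * (if ε = 1 then cyclotomicOmegaMinus p n else cyclotomicOmegaPlus p n)).map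
                (Int.castRingHom (PadicAlgCl p)) : (PadicAlgCl p)[X]) : PowerSeries (PadicAlgCl p)) *
              iwasawaOToPowerSeries (Set.range ι) L)) →
          ∃ d : ℕ, (∀ k : ℕ, ‖PowerSeries.coeff k (iwasawaOToPowerSeries (Set.range ι) L)‖ ≤
              ‖PowerSeries.coeff d (iwasawaOToPowerSeries (Set.range ι) L)‖) ∧
            (∀ k : ℕ, k < d → ‖PowerSeries.coeff k (iwasawaOToPowerSeries (Set.range ι) L)‖ <
              ‖PowerSeries.coeff d (iwasawaOToPowerSeries (Set.range ι) L)‖) ∧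
            d + ∑ v ∈ S₀, p ^ (frobeniusExponent p (natGenerator v : ℤ_[p])).valuation *
              layerLambda ((1 - C (embCoeff g ι (natGenerator v)) * X +
                (if natGenerator v ∣ M then 0 else C (natGenerator v : PadicAlgCl p)) * X ^ 2).comp
                  (C ((natGenerator v : PadicAlgCl p)⁻¹) * (X + 1))) ≤
              lambdaInvariant p D.X + ∑ v ∈ S₀, delta W p v) :
    ∀ (W : WeierstrassCurve ℚ) [W.IsElliptic] [W.IsGloballyMinimal] (p : ℕ) [Fact p.Prime],
      p ≠ 2 → ClassX7 W p → ¬ W.HasCM → W.frobeniusTrace p = 0 → ¬ Surj W p →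
      ¬ (∃ (A : WeierstrassCurve ℚ) (_ : A.IsElliptic) (_ : A.IsGloballyMinimal),
        A.HasCM ∧ GoodSS A p ∧ A.frobeniusTrace p = 0 ∧
          ∃ e : geomTorsion W (p : ℤ) ≃+ geomTorsion A (p : ℤ),
            ∀ (σ : absoluteGaloisGroup ℚ) (P : geomTorsion W (p : ℤ)), e (σ • P) = σ • e P) →
      ¬ (∃ (A : WeierstrassCurve ℚ) (_ : A.IsElliptic) (_ : A.IsGloballyMinimal) (t : ℚ),
        A.HasGoodReductionAtPrime p ∧ A.frobeniusTrace p = 0 ∧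
          (∃ e : geomTorsion W (p : ℤ) ≃+ geomTorsion A (p : ℤ),
            ∀ (σ : absoluteGaloisGroup ℚ) (P : geomTorsion W (p : ℤ)), e (σ • P) = σ • e P) ∧
          A.entireLFunction 1 / (A.realPeriodRat : ℂ) = ((t : ℚ) : ℂ) ∧ t ≠ 0 ∧ padicValRat p t = 0) →
      ∀ (ε : ℤˣ), ∃ (M : ℕ) (_ : NeZero M) (g : CuspForm (Gamma0 M) 2) (ι : coeffField g →+* PadicAlgCl p) (Ω : ℂ),
        ¬ p ∣ M ∧ IsNewform0 g ∧ Literature.NumberTheory.Automorphic.IsCMForm (liftToGamma1 M 2 g) ∧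
          cuspCoeff g p = 0 ∧ IsCohomologicalPlusPeriod g ι Ω ∧
          (∀ ℓ : ℕ, ℓ.Prime → ¬ ℓ ∣ p * M * W.conductorNorm ℤ →
            ‖embCoeff g ι ℓ - (W.frobeniusTrace ℓ : PadicAlgCl p)‖ < 1) ∧
          ∀ (κ : ZpExtension ℚ p) (γ : absoluteGaloisGroup ℚ),
            κ.IsCyclotomic → κ.IsTopGenerator γ → IsCyclotomicVariable p γ →
          ∀ (S₀ : Finset (HeightOneSpectrum (𝓞 ℚ))), (∀ v ∈ S₀, ((p : ℕ) : 𝓞 ℚ) ∉ v.asIdeal) →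
            (∀ v : HeightOneSpectrum (𝓞 ℚ), ¬ W.HasGoodReductionAt v → v ∈ S₀) →
            (∀ v : HeightOneSpectrum (𝓞 ℚ), natGenerator v ∣ M → v ∈ S₀) →
          ∀ (D : SignedSelmerDualData W κ γ ε) [Module.Finite (IwasawaAlgebra p) D.X],
            Module.IsTorsion (IwasawaAlgebra p) D.X → D.mu = 0 →
          ∀ L : IwasawaAlgebraO (Set.range ι), L ≠ 0 →
            (∀ n : ℕ, (Even n ↔ ε = 1) → IsCongrModOmegaO (Set.range ι) n ((mazurTateElementK g Ω p n).map ι)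
              (((((-1) ^ (n / 2 + 1) * (if ε = 1 then cyclotomicOmegaMinus p n else cyclotomicOmegaPlus p n)).map
                  (Int.castRingHom (PadicAlgCl p)) : (PadicAlgCl p)[X]) : PowerSeries (PadicAlgCl p)) *
                iwasawaOToPowerSeries (Set.range ι) L)) →
            ∃ d : ℕ, (∀ k : ℕ, ‖PowerSeries.coeff k (iwasawaOToPowerSeries (Set.range ι) L)‖ ≤
                ‖PowerSeries.coeff d (iwasawaOToPowerSeries (Set.range ι) L)‖) ∧
              (∀ k : ℕ, k < d → ‖PowerSeries.coeff k (iwasawaOToPowerSeries (Set.range ι) L)‖ <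
                ‖PowerSeries.coeff d (iwasawaOToPowerSeries (Set.range ι) L)‖) ∧
              d + ∑ v ∈ S₀, p ^ (frobeniusExponent p (natGenerator v : ℤ_[p])).valuation *
                layerLambda ((1 - C (embCoeff g ι (natGenerator v)) * X +
                  (if natGenerator v ∣ M then 0 else C (natGenerator v : PadicAlgCl p)) * X ^ 2).comp
                    (C ((natGenerator v : PadicAlgCl p)⁻¹) * (X + 1))) ≤
                lambdaInvariant p D.X + ∑ v ∈ S₀, delta W p v := by
  intro W _ _ p _ hp hX hcm hap hs hT1 hTu ε
  obtain ⟨K, _, _, σK, 𝔪, ψ, e, hK2, htc, h𝔪, hnop, hpD, hbad, hψG, hneb, htrace, hv, hpd, -, Φ, k, e₀, he₀, hk, h2, htr, hGN, hUle, hKU,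
      hprim, hdK, h𝔪c⟩ :=
    Summit.BirchSwinnertonDyer.BirchSwinnertonDyer.Theorems.SmallImageLambdaLowerThreeNsThetaPartner.exists_arithmeticHalf_classwide_sharp₃ W p hp hX hs
  obtain ⟨M, hM, g, ι, Ω, -, hpM, hnew, hcmf, hapg, hΩ, hcong, hcoeff⟩ :=
    Summit.BirchSwinnertonDyer.BirchSwinnertonDyer.Theorems.SmallImageLambdaLowerThreeNsThetaPartner.heckeThetaPartner_withCoeff_of_arithmeticHalf
      W p K hK2 htc σK 𝔪 h𝔪 ψ e hnop hpD (fun ℓ _ => hbad ℓ) hψG hneb (fun ℓ _ => htrace ℓ)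
  haveI := hM
  exact ⟨M, hM, g, ι, Ω, hpM, hnew, hcmf, hapg, hΩ, hcong,
    hPSBθ W p hp hX hcm hap hs hT1 hTu ε K σK 𝔪 ψ e hK2 htc h𝔪 hnop hpD (fun ℓ _ => hbad ℓ) hψG hneb (fun ℓ _ => htrace ℓ) hv hpd
      hprim hdK h𝔪c Φ k e₀ he₀ hk h2 htr hGN hUle hKU M g ι Ω hpM hnew hcmf hapg hΩ hcong hcoeff⟩

end Summit.BirchSwinnertonDyer.BirchSwinnertonDyer.Theorems.SmallImageRttOneSided

end
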